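import Summits.BirchSwinnertonDyer.BirchSwinnertonDyer.Theorems.QuadraticBranchSignedControlPlusEtaNonsurjConjADoorHecke
import Summits.BirchSwinnertonDyer.BirchSwinnertonDyer.Theorems.QuadraticBranchSignedControlPlusEtaNonsurjCartanField
import Summits.BirchSwinnertonDyer.BirchSwinnertonDyer.Theorems.QuadraticBranchSignedControlPlusEtaNonsurjPartnerIdle
import HarnessLib

/-!
# Route `QuadraticBranchSignedControl` (rung K8, cell `bsd-potss`), residual crux `PlusEtaMainConjectureNonsurj`
# (stmt-BirchSwinnertonDyer-19606): THE HYPOTHESIS `hVH` OF THE HECKE DOOR IS AUTOMATIC — on a row and on its partner the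
# `Γ_{ℚ(P)}`-fixed vectors of `E[p]` are exactly the multiples of `P` (seat `bsd-potss-k8eta-c2` g21, sequel of p704214 / p705609)

WHY. The fact-free Hecke door `EtaConjADoorHecke.conjA_of_heckeEigenHom_subfield` (p704214) and its four fine-road compositions
(p705609) display, next to the Hecke-refined eigen datum on `Cl(ℚ(P))`, the hypothesis `hVH`: «every `v ∈ W[p]` fixed by the absolute
Galois group of the stabiliser field `K = ℚ(P)` is a multiple of `P`». On the rows of crux 19606 and on their partners this is a
THEOREM of the kernel, not a datum: the mod-`p` image is EXACTLY the normaliser `C_ns⁺(ε)` of a non-split Cartan subgroup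
(`EtaCartanField.hasModPImageEqNonsplitCartanNormalizer_of_row`, from Serre's Prop. 12/17 and the lifting lemma), the Cartan subgroup
`C_ns(ε) ≅ 𝔽_{p²}ˣ` acts freely on `E[p] ∖ 0`, and for every `x ≠ 0` the coset `C_ns⁺ ∖ C_ns` contains exactly one element `s_x` with
`s_x x = x` — an involution of determinant `−1` (the "reflection" `y ↦ x·ȳ·x̄⁻¹` of `𝔽_{p²}`), whose fixed space is the LINE `𝔽_p x`
because `p ≠ 2`. So `Stab(P) ∋ s_P ≠ 1` and `E[p]^{Stab(P)} ⊆ E[p]^{s_P} = 𝔽_p P`.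

WHAT (tool theorems, fact-free).
* §1 matrices over `𝔽_p` (`p` odd, `ε` a non-square): `normForm_ne_zero_of_ne_zero` (`x₀² − εx₁² ≠ 0` for `x ≠ 0`),
  `exists_coset_mulVec_eq_self` (an element `(a, −εb; b, −a)` of the non-trivial coset fixing a given `x ≠ 0`: `a = (x₀² + εx₁²)/N`,
  `b = 2x₀x₁/N`), `exists_smul_eq_of_coset_mulVec_eq_self` (the fixed vectors of such an element are the multiples of `x`: two
  independent fixed vectors force `a = 1` AND `a = −1`).
* §2 `exists_nsmul_eq_of_stabilizer_fixed` — for ANY `E/ℚ` with `Im ρ̄_{E,p} = C_ns⁺(ε)` exactly and `P ∈ E[p] ∖ 0`: a `v ∈ E[p]` fixed by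
  every `τ ∈ Γ_ℚ` fixing `P` is `c • P` for some `c : ℕ`.
* §3 `hasModPImageEqNonsplitCartanNormalizer_partner` — the PARTNER `W` of a row `V` (`C • W^{(p*)} = V`, `V` globally minimal,
  `p ≥ 5` good, `a_p(V) = 0`, tower not onto) ALSO has image exactly `C_ns⁺(ε)`: the frame of `V` pulled back along the signed twisting
  isomorphism `t : W[p] ≃+ V[p]` (`t(σx) = ±σ t(x)`); surjectivity uses the common inertial `−1` of the pair (p690512
  `EtaConjADoor.exists_mem_inertia_smul_eq_neg_pair`) to flip a wrong sign. (p690512 had the containment `⊆` only, `…PartnerIdle`.)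
* §4 `stabilizerField_fixed_line_of_row` / `stabilizerField_fixed_line_partner` — `hVH` in the door's own syntax (`K` = the fixed field of
  the image of `Stab(P)` in `Gal(ℚ(E[p])/ℚ)`).
* §5 **`conjA_partner_of_heckeEigenHom_auto`** — p704214's `conjA_partner_of_heckeEigenHom` with `hVH` DISCHARGED: statement (A) for the
  partner `W` from the Hecke-refined tautological eigen datum on `Cl(ℚ(P))` ALONE (numerically: hecke13 verdict TWIST-TYPE / `T = 0`,
  18/18 open rows of the k8eta-c2 g21 census at `p = 5`); and `conjA_row_of_heckeEigenHom_auto`, the same on the ROW `V` itself.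

HONEST FRAMING (cell `bsd-potss`; FULL-BSD rank ≤ 1 programme, HUMAN RULING D-0036/D-0074): TOOL THEOREMS ONLY — no definition, no named
fact, no `sorry`, axioms standard; the Hecke eigen datum stays displayed (GRH class-group computations are evidence, never facts). No stub of
19606 is proved by name; the crux stays OPEN; nothing is booked; (A) and `BSD(W,p)` are claimed for no pair. `--supports stmt-BirchSwinnertonDyer-19606 --as helper`.

References: [Serre1972] §2.2 (Cartan subgroups and their normalisers), §1.11 Prop. 12, §2.7 Prop. 17; [SilvermanAEC2009] X.5 Cor. 5.4;
[CoatesSujatha2005] §3 Thm. 3.4, Lemma 3.8; [DeoRaySujatha2023] Thm. 3.8 (arXiv:2202.09937 p. 9).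
-/

set_option autoImplicit false
set_option linter.dupNamespace false
noncomputable section

open scoped Classical nonZeroDivisors

open Matrix NumberField IsDedekindDomain Field WeierstrassCurve
open Literature.NumberTheory.EllipticCurves Literature.NumberTheory.GaloisRepresentations
  Literature.NumberTheory.EllipticCurves.Rank1Residual Literature.NumberTheory.NumberFields
  Literature.NumberTheory.SerreUniformity Rat.HeightOneSpectrum
open Literature.NumberTheory.EllipticCurves.GreenbergSelmer (decomp)
open Summit.BirchSwinnertonDyer.Rank1Residual Summit.BirchSwinnertonDyer.Rank1Residual.GaloisImage
open Summit.BirchSwinnertonDyer.BirchSwinnertonDyer.Theorems.EtaCartanField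
open Summit.BirchSwinnertonDyer.BirchSwinnertonDyer.Theorems.EtaConjADoor

namespace Summit.BirchSwinnertonDyer.BirchSwinnertonDyer.Theorems.EtaConjADoorHecke

/-! ## §1 Matrices: the reflection of `C_ns⁺(ε) ∖ C_ns(ε)` fixing a given vector, and its fixed line -/

section Matrices

variable {p : ℕ} [hp : Fact p.Prime]

/-- `2 ≠ 0` in `𝔽_p` for `p ≠ 2`. [folklore] -/
private theorem two_ne_zero_zmod (hp2 : p ≠ 2) : (2 : ZMod p) ≠ 0 :=
  Ring.two_ne_zero (by rw [ZMod.ringChar_zmod_n]; exact hp2)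

/-- **The norm form `x₀² − εx₁²` of `𝔽_p[√ε]` is anisotropic**: it vanishes only at `x = 0` when `ε` is a non-square. [cite: Serre1972, §2.2] -/
theorem normForm_ne_zero_of_ne_zero {ε : ZMod p} (hε : ¬ IsSquare ε) {x : Fin 2 → ZMod p} (hx : x ≠ 0) :
    x 0 * x 0 - ε * x 1 * x 1 ≠ 0 := by
  intro h
  by_cases hx1 : x 1 = 0
  · have hx0 : x 0 = 0 := by
      rw [hx1, mul_zero, sub_zero] at h
      exact mul_self_eq_zero.mp h
    exact hx (funext fun i => by fin_cases i <;> assumption)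
  · apply hε
    refine ⟨x 0 / x 1, ?_⟩
    field_simp
    linear_combination -h

/-- **The reflection fixing `x`.** For `ε` a non-square, `p ≠ 2` and `x ≠ 0` there is an element `(a, −εb; b, −a)` of the non-trivial
coset of `C_ns(ε)` in `C_ns⁺(ε)` with `(a, b) ≠ (0, 0)` fixing `x`: `a = (x₀² + εx₁²)/N`, `b = 2x₀x₁/N`, `N = x₀² − εx₁²` (in `𝔽_{p²} = 𝔽_p[√ε]`:
the map `y ↦ (x/x̄)·ȳ`). [cite: Serre1972, §2.2] -/
theorem exists_coset_mulVec_eq_self {ε : ZMod p} (hε : ¬ IsSquare ε) {x : Fin 2 → ZMod p} (hx : x ≠ 0) :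
    ∃ a b : ZMod p, (a, b) ≠ (0, 0) ∧ !![a, -(ε * b); b, -a] *ᵥ x = x := by
  have hN := normForm_ne_zero_of_ne_zero hε hx
  -- `a = (x₀² + εx₁²)/N`, `b = 2x₀x₁/N`
  obtain ⟨a, b, ha, hb⟩ : ∃ a b : ZMod p, a * (x 0 * x 0 - ε * x 1 * x 1) = x 0 * x 0 + ε * x 1 * x 1 ∧
      b * (x 0 * x 0 - ε * x 1 * x 1) = 2 * x 0 * x 1 :=
    ⟨_, _, div_mul_cancel₀ _ hN, div_mul_cancel₀ _ hN⟩
  have e0 : a * x 0 + -(ε * b * x 1) = x 0 := by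
    have h : (a * x 0 + -(ε * b * x 1) - x 0) * (x 0 * x 0 - ε * x 1 * x 1) = 0 := by
      linear_combination (x 0) * ha - (ε * x 1) * hb
    exact sub_eq_zero.mp ((mul_eq_zero.mp h).resolve_right hN)
  have e1 : b * x 0 + -(a * x 1) = x 1 := by
    have h : (b * x 0 + -(a * x 1) - x 1) * (x 0 * x 0 - ε * x 1 * x 1) = 0 := by
      linear_combination (x 0) * hb - (x 1) * ha
    exact sub_eq_zero.mp ((mul_eq_zero.mp h).resolve_right hN)
  have hMx : !![a, -(ε * b); b, -a] *ᵥ x = x := by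
    funext i
    fin_cases i
    · simp [Matrix.mulVec, dotProduct, Fin.sum_univ_two]
      linear_combination e0
    · simp [Matrix.mulVec, dotProduct, Fin.sum_univ_two]
      linear_combination e1
  refine ⟨a, b, fun h0 => hx ?_, hMx⟩
  simp only [Prod.mk.injEq] at h0
  rw [← hMx, h0.1, h0.2]
  funext i
  fin_cases i <;> simp [Matrix.mulVec, dotProduct, Fin.sum_univ_two]

/-- **The fixed vectors of a reflection form a line**: if `(a, −εb; b, −a)` (`p ≠ 2`) fixes `x ≠ 0` and `y`, then `y = c • x` — two
independent fixed vectors would give `a = 1` from the first rows and `a = −1` from the second rows. [cite: Serre1972, §2.2] -/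
theorem exists_smul_eq_of_coset_mulVec_eq_self (hp2 : p ≠ 2) {ε a b : ZMod p} {x y : Fin 2 → ZMod p} (hx : x ≠ 0)
    (hMx : !![a, -(ε * b); b, -a] *ᵥ x = x) (hMy : !![a, -(ε * b); b, -a] *ᵥ y = y) :
    ∃ c : ZMod p, y = c • x := by
  have h1 := congrFun hMx 0
  have h2 := congrFun hMx 1
  have h3 := congrFun hMy 0
  have h4 := congrFun hMy 1
  simp [Matrix.mulVec, dotProduct, Fin.sum_univ_two] at h1 h2 h3 h4
  by_cases hD : x 0 * y 1 - x 1 * y 0 = 0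
  · by_cases hx0 : x 0 = 0
    · have hx1 : x 1 ≠ 0 := fun hx1 => hx (funext fun i => by fin_cases i <;> assumption)
      have hy0 : y 0 = 0 := by
        rw [hx0, zero_mul, zero_sub, neg_eq_zero] at hD
        exact (mul_eq_zero.mp hD).resolve_left hx1
      refine ⟨y 1 / x 1, funext fun i => ?_⟩
      fin_cases i
      · simp [hx0, hy0]
      · simp only [Fin.mk_one, Pi.smul_apply, smul_eq_mul]
        field_simp
    · refine ⟨y 0 / x 0, funext fun i => ?_⟩
      fin_cases i
      · simp only [Fin.zero_eta, Pi.smul_apply, smul_eq_mul]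
        field_simp
      · simp only [Fin.mk_one, Pi.smul_apply, smul_eq_mul]
        field_simp
        linear_combination hD
  · exfalso
    have ha1 : (a - 1) * (x 0 * y 1 - x 1 * y 0) = 0 := by linear_combination (y 1) * h1 - (x 1) * h3
    have ha2 : (a + 1) * (x 0 * y 1 - x 1 * y 0) = 0 := by linear_combination (y 0) * h2 - (x 0) * h4
    have e1 : a - 1 = 0 := (mul_eq_zero.mp ha1).resolve_right hD
    have e2 : a + 1 = 0 := (mul_eq_zero.mp ha2).resolve_right hD
    exact two_ne_zero_zmod hp2 (by linear_combination e2 - e1)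

end Matrices

/-! ## §2 Curve-generic: under `Im ρ̄ = C_ns⁺(ε)` the fixed vectors of `Stab(P)` are the multiples of `P` -/

section Generic

variable {p : ℕ} [hp : Fact p.Prime]

/-- **`E[p]^{Stab(P)} = 𝔽_p•P` under an exact `C_ns⁺` image.** Let `E/ℚ` have mod-`p` image EXACTLY `C_ns⁺(ε)` (`p ≠ 2`) and let
`P ∈ E[p] ∖ 0`. Then every `v ∈ E[p]` fixed by all `τ ∈ Γ_ℚ` with `τ • P = P` is `c • P` for some `c : ℕ`: the reflection `s_P` of §1
is the matrix of some `σ` (exactness of the image), `σ` fixes `P`, hence `v`, and the fixed space of `s_P` is the line through `P`.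
[cite: Serre1972, §2.2] -/
theorem exists_nsmul_eq_of_stabilizer_fixed (hp2 : p ≠ 2) {E : WeierstrassCurve ℚ}
    (h : HasModPImageEqNonsplitCartanNormalizer E p) {P : E.geomTorsion p} (hP : P ≠ 0) (v : E.geomTorsion p)
    (hv : ∀ τ : absoluteGaloisGroup ℚ, τ • P = P → τ • v = v) : ∃ c : ℕ, v = c • P := by
  obtain ⟨e, ε, hε, -, hsurj⟩ := h
  have hx : e P ≠ 0 := fun h0 => hP (e.injective (by rw [h0, map_zero]))
  obtain ⟨a, b, hab, hMx⟩ := exists_coset_mulVec_eq_self hε hx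
  obtain ⟨σ, hσ⟩ := hsurj _ ⟨a, b, hab, Or.inr rfl⟩
  have hσP : σ • P = P := e.injective (by rw [hσ, hMx])
  have hMy : !![a, -(ε * b); b, -a] *ᵥ e v = e v := by rw [← hσ, hv σ hσP]
  obtain ⟨c, hc⟩ := exists_smul_eq_of_coset_mulVec_eq_self hp2 hx hMx hMy
  refine ⟨c.val, e.injective ?_⟩
  rw [map_nsmul, hc, ← Nat.cast_smul_eq_nsmul (ZMod p), ZMod.natCast_zmod_val]

/-- **A non-trivial stabiliser.** Under an exact `C_ns⁺` image (`p ≠ 2`) every `P ∈ E[p] ∖ 0` is fixed by some `σ ∈ Γ_ℚ` acting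
NON-trivially on `E[p]` (the reflection `s_P`; so `[ℚ(E[p]) : ℚ(P)] = 2` and `ℚ(P)` has degree `p² − 1`). [cite: Serre1972, §2.2] -/
theorem exists_smul_eq_self_and_ne (hp2 : p ≠ 2) {E : WeierstrassCurve ℚ}
    (h : HasModPImageEqNonsplitCartanNormalizer E p) {P : E.geomTorsion p} (hP : P ≠ 0) :
    ∃ σ : absoluteGaloisGroup ℚ, σ • P = P ∧ ∃ Q : E.geomTorsion p, σ • Q ≠ Q := by
  obtain ⟨e, ε, hε, -, hsurj⟩ := h
  have hx : e P ≠ 0 := fun h0 => hP (e.injective (by rw [h0, map_zero]))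
  obtain ⟨a, b, hab, hMx⟩ := exists_coset_mulVec_eq_self hε hx
  obtain ⟨σ, hσ⟩ := hsurj _ ⟨a, b, hab, Or.inr rfl⟩
  refine ⟨σ, e.injective (by rw [hσ, hMx]), ?_⟩
  by_contra hall
  simp only [ne_eq, not_exists, not_not] at hall
  -- `σ` would act trivially: its matrix is `1 ∈ C_ns(ε)`, but it lies in the other coset
  have h1 : ∀ Q : E.geomTorsion p, e (σ • Q) = (1 : Matrix (Fin 2) (Fin 2) (ZMod p)) *ᵥ e Q := fun Q => by
    rw [hall Q, Matrix.one_mulVec]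
  have hM1 : (!![a, -(ε * b); b, -a] : Matrix (Fin 2) (Fin 2) (ZMod p)) = 1 := matrix_unique e hσ h1
  exact coset_not_mem_nonsplitCartan hp2 hε hab (hM1 ▸ one_mem_nonsplitCartan ε)

end Generic

/-! ## §3 The partner of a row of crux 19606 has image exactly `C_ns⁺(ε)` too -/

section K8

variable (p : ℕ) [hp : Fact p.Prime]
variable (V : WeierstrassCurve ℚ) [V.IsElliptic] [V.IsGloballyMinimal] (W : WeierstrassCurve ℚ) (C : VariableChange ℚ)

/-- **Exact image for the partner.** On a row of crux 19606 (`V` globally minimal, `p ≥ 5` good, `a_p(V) = 0`, tower not onto) with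
partner `W` (`C • W^{(p*)} = V`): `Im ρ̄_{W,p}` is EXACTLY `C_ns⁺(ε)` — in the frame `e_V ∘ t` of `W[p]`, `t : W[p] ≃+ V[p]` the signed
twisting isomorphism, the matrix of `σ` is `±ρ̄_V(σ) ∈ C_ns⁺(ε)`; conversely `M = ρ̄_V(σ)` is the `W`-matrix of `σ` or of `σz`, `z` the
common inertial `−1` of the pair. [cite: SilvermanAEC2009, X.5 Cor. 5.4] [cite: Serre1972, §2.2 and §2.7 Prop. 17] -/
theorem hasModPImageEqNonsplitCartanNormalizer_partner (hp5 : 5 ≤ p) (hC : C • W.quadraticTwist ((-1) ^ (p / 2) * p) = V)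
    (hgood : V.HasGoodReductionAtPrime p) (hap : V.frobeniusTrace p = 0)
    (hns : ¬ ∀ m : ℕ, V.HasSurjectiveModNGaloisRep (p ^ m : ℕ)) : HasModPImageEqNonsplitCartanNormalizer W p := by
  obtain ⟨e, ε, hε, himg, hsurj⟩ := hasModPImageEqNonsplitCartanNormalizer_of_row V p hp5 hgood hap hns
  obtain ⟨z, -, hzW, -⟩ := exists_mem_inertia_smul_eq_neg_pair V p W C hp5 hgood hap hC
    (natCast_mem_asIdeal_iff_eq_primesEquiv_symm _ hp.out |>.mpr rfl)
    (adicCompletionPrime_mem_primesAbove ℚ (primesEquiv.symm ⟨p, hp.out⟩))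
  obtain ⟨t, ht⟩ := exists_torsion_addEquiv_signed_of_model_twist W p V (Additive.pStar_ne_zero p) ⟨C, hC⟩
  refine ⟨t.trans e, ε, hε, fun σ => ?_, fun M hM => ?_⟩
  · obtain ⟨M, hM, hσ⟩ := himg σ
    rcases ht σ with h | h
    · exact ⟨M, hM, fun P => by rw [AddEquiv.trans_apply, h, hσ, AddEquiv.trans_apply]⟩
    · refine ⟨-M, neg_mem_nonsplitCartanNormalizer hM, fun P => ?_⟩
      rw [AddEquiv.trans_apply, h, map_neg, hσ, AddEquiv.trans_apply, Matrix.neg_mulVec]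
  · obtain ⟨σ, hσ⟩ := hsurj M hM
    rcases ht σ with h | h
    · exact ⟨σ, fun P => by rw [AddEquiv.trans_apply, h, hσ, AddEquiv.trans_apply]⟩
    · refine ⟨σ * z, fun P => ?_⟩
      rw [AddEquiv.trans_apply, mul_smul, hzW, smul_neg, map_neg, h, neg_neg, hσ, AddEquiv.trans_apply]

/-! ## §4 `hVH` in the syntax of the Hecke door: on the row and on the partner -/

/-- **`hVH` holds under an exact `C_ns⁺` image**, in the syntax of p704214: for `K` the fixed field of the image of `Stab(P)` in
`Gal(ℚ(E[p])/ℚ)` (the stabiliser field `ℚ(P)`), every `v ∈ E[p]` fixed by all `τ` whose restriction fixes `K` pointwise is `c • P`.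
[cite: Serre1972, §2.2] -/
theorem stabilizerField_fixed_line {E : WeierstrassCurve ℚ} [E.IsElliptic] (hp2 : p ≠ 2)
    (h : HasModPImageEqNonsplitCartanNormalizer E p) (P : geomTorsion E (p : ℤ)) (hP0 : P ≠ 0)
    (K : IntermediateField ℚ (E.divisionField p))
    (hK : K = IntermediateField.fixedField
      ((MulAction.stabilizer (absoluteGaloisGroup ℚ) P).map (absRestrictNormalHom (E.divisionField p))))
    (v : geomTorsion E (p : ℤ))
    (hv : ∀ τ : absoluteGaloisGroup ℚ,
      (∀ x : K, absRestrictNormalHom (E.divisionField p) τ (x : E.divisionField p) = x) → τ • v = v) :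
    ∃ c : ℕ, v = c • P := by
  refine exists_nsmul_eq_of_stabilizer_fixed hp2 h hP0 v fun τ hτ => hv τ fun x => ?_
  have hx : (x : E.divisionField p) ∈ IntermediateField.fixedField
      ((MulAction.stabilizer (absoluteGaloisGroup ℚ) P).map (absRestrictNormalHom (E.divisionField p))) := hK ▸ x.2
  rw [IntermediateField.mem_fixedField_iff] at hx
  exact hx _ (Subgroup.mem_map_of_mem _ (MulAction.mem_stabilizer_iff.mpr hτ))

/-- **`hVH` on a ROW of crux 19606** (`V` globally minimal, `p ≥ 5` good, `a_p = 0`, tower not onto), for every `P ∈ V[p] ∖ 0`.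
[cite: Serre1972, §2.2 and §2.7 Prop. 17] -/
theorem stabilizerField_fixed_line_of_row (hp5 : 5 ≤ p) (hgood : V.HasGoodReductionAtPrime p) (hap : V.frobeniusTrace p = 0)
    (hns : ¬ ∀ m : ℕ, V.HasSurjectiveModNGaloisRep (p ^ m : ℕ)) (P : geomTorsion V (p : ℤ)) (hP0 : P ≠ 0)
    (K : IntermediateField ℚ (V.divisionField p))
    (hK : K = IntermediateField.fixedField
      ((MulAction.stabilizer (absoluteGaloisGroup ℚ) P).map (absRestrictNormalHom (V.divisionField p))))
    (v : geomTorsion V (p : ℤ))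
    (hv : ∀ τ : absoluteGaloisGroup ℚ,
      (∀ x : K, absRestrictNormalHom (V.divisionField p) τ (x : V.divisionField p) = x) → τ • v = v) :
    ∃ c : ℕ, v = c • P :=
  stabilizerField_fixed_line p (by omega) (hasModPImageEqNonsplitCartanNormalizer_of_row V p hp5 hgood hap hns) P hP0 K hK v hv

/-- **`hVH` on the PARTNER `W` of a row of crux 19606** (`C • W^{(p*)} = V`), for every `P ∈ W[p] ∖ 0`. [cite: Serre1972, §2.2]
[cite: SilvermanAEC2009, X.5 Cor. 5.4] -/
theorem stabilizerField_fixed_line_partner [W.IsElliptic] (hp5 : 5 ≤ p)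
    (hC : C • W.quadraticTwist ((-1) ^ (p / 2) * p) = V) (hgood : V.HasGoodReductionAtPrime p)
    (hap : V.frobeniusTrace p = 0) (hns : ¬ ∀ m : ℕ, V.HasSurjectiveModNGaloisRep (p ^ m : ℕ))
    (P : geomTorsion W (p : ℤ)) (hP0 : P ≠ 0) (K : IntermediateField ℚ (W.divisionField p))
    (hK : K = IntermediateField.fixedField
      ((MulAction.stabilizer (absoluteGaloisGroup ℚ) P).map (absRestrictNormalHom (W.divisionField p))))
    (v : geomTorsion W (p : ℤ))
    (hv : ∀ τ : absoluteGaloisGroup ℚ,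
      (∀ x : K, absRestrictNormalHom (W.divisionField p) τ (x : W.divisionField p) = x) → τ • v = v) :
    ∃ c : ℕ, v = c • P :=
  stabilizerField_fixed_line p (by omega) (hasModPImageEqNonsplitCartanNormalizer_partner p V W C hp5 hC hgood hap hns)
    P hP0 K hK v hv

/-! ## §5 The Hecke door with `hVH` discharged: (A) from the Hecke-refined eigen datum ALONE -/

/-- **(A) on the PARTNER `W` of a row of crux 19606 from the Hecke-refined eigen datum ALONE** (`C • W^{(p*)} = V`, `V` globally
minimal, `p ≥ 5` good, `a_p(V) = 0`, tower not onto): for one `P ∈ W[p] ∖ 0` with `K = ℚ(P)` the stabiliser field, the Hecke-refined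
tautological eigen-test on `Cl(𝓞_K) ⊗ 𝔽_p` (every additive `μ : Cl(𝓞_K) → ℤ/p` with the tautological relations `μ[σ̄I] = a•μ[I]`
(`τ|_K = σ̄`, `τ•P = a•P`) AND the Hecke relations `μ(N_{L/K}(τ·i[I])) = (#Gal(L/K)·a)•μ[I]` (`τ•P = a•P + Q`, `Q` in another eigenline)
vanishes; kit: hecke13 verdict TWIST-TYPE or `T = 0`) ⟹ statement (A) for `(W, p)`. p704214's door with `hVH` supplied by §4; (c1), (c3),
irreducibility by p690512. NO named fact. [cite: CoatesSujatha2005, §3 Thm. 3.4 and Lemma 3.8]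
[cite: DeoRaySujatha2023, §3 Thm. 3.8 (c1)–(c3) (arXiv:2202.09937 p. 9)] [cite: Serre1972, §2.2] [cite: SilvermanAEC2009, X.5 Cor. 5.4] -/
theorem conjA_partner_of_heckeEigenHom_auto [W.IsElliptic] [NeZero p] (hp5 : 5 ≤ p)
    (hC : C • W.quadraticTwist ((-1) ^ (p / 2) * p) = V)
    (hgood : V.HasGoodReductionAtPrime p) (hap : V.frobeniusTrace p = 0)
    (hns : ¬ ∀ m : ℕ, V.HasSurjectiveModNGaloisRep (p ^ m : ℕ))
    (hP : haveI : NumberField (W.divisionField p) := NumberField.mk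
      ∃ P : geomTorsion W (p : ℤ), P ≠ 0 ∧
        ∀ K : IntermediateField ℚ (W.divisionField p),
          K = IntermediateField.fixedField
            ((MulAction.stabilizer (absoluteGaloisGroup ℚ) P).map (absRestrictNormalHom (W.divisionField p))) →
        ∀ μ : Additive (ClassGroup (𝓞 K)) →+ ZMod p,
          (∀ (τ : absoluteGaloisGroup ℚ) (σ : K ≃ₐ[ℚ] K) (a : ℕ),
              (∀ x : K, absRestrictNormalHom (W.divisionField p) τ (x : W.divisionField p) =
                ((σ x : K) : W.divisionField p)) → τ • P = a • P →
              ∀ (I J : (Ideal (𝓞 K))⁰),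
                (J : Ideal (𝓞 K)) = (I : Ideal (𝓞 K)).map (AmbiguousClass.intAut σ : 𝓞 K →+* 𝓞 K) →
                μ (Additive.ofMul (ClassGroup.mk0 J)) = a • μ (Additive.ofMul (ClassGroup.mk0 I))) →
          (∀ (τ τ₁ : absoluteGaloisGroup ℚ) (a a₁ b : ℕ) (Q : geomTorsion W (p : ℤ)),
              τ • P = a • P + Q → τ₁ • P = a₁ • P → τ₁ • Q = b • Q → (a₁ : ZMod p) ≠ (b : ZMod p) →
              ∀ I : (Ideal (𝓞 K))⁰,
                μ (Additive.ofMul (classGroupNorm K (W.divisionField p) (ClassGroup.mulEquiv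
                  (AmbiguousClass.intAut (absRestrictNormalHom (W.divisionField p) τ))
                    (classGroupExtend K (W.divisionField p) (ClassGroup.mk0 I))))) =
                  (Nat.card ((W.divisionField p) ≃ₐ[K] (W.divisionField p)) * a) •
                    μ (Additive.ofMul (ClassGroup.mk0 I))) →
          μ = 0)
    (κ : ZpExtension ℚ p) (hκ : κ.IsCyclotomic) :
    ∃ (γ : absoluteGaloisGroup ℚ) (D : W.FineSelmerDualData κ γ),
      Module.Finite ℤ_[p] (RestrictScalars ℤ_[p] (IwasawaAlgebra p) D.X) := by
  haveI : NumberField (W.divisionField p) := NumberField.mk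
  obtain ⟨P, hP0, h⟩ := hP
  exact conjA_partner_of_heckeEigenHom p V W C hp5 hC hgood hap hns
    ⟨P, hP0, fun K hK => ⟨fun v hv => stabilizerField_fixed_line_partner p V W C hp5 hC hgood hap hns P hP0 K hK v hv,
      h K hK⟩⟩ κ hκ

/-- **(A) on a ROW `V` of crux 19606 from the Hecke-refined eigen datum ALONE** (`V` globally minimal, `p ≥ 5` good, `a_p = 0`,
tower not onto; `K = ℚ(P)` for one `P ∈ V[p] ∖ 0`): p704214's curve-generic door `conjA_of_heckeEigenHom_subfield` with (c1), (c3),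
irreducibility from p690512 and `hVH` from §4. NO named fact. [cite: CoatesSujatha2005, §3 Thm. 3.4 and Lemma 3.8]
[cite: DeoRaySujatha2023, §3 Thm. 3.8 (c1)–(c3) (arXiv:2202.09937 p. 9)] [cite: Serre1972, §1.11 Prop. 12 and §2.2] -/
theorem conjA_row_of_heckeEigenHom_auto [NeZero p] (hp5 : 5 ≤ p)
    (hgood : V.HasGoodReductionAtPrime p) (hap : V.frobeniusTrace p = 0)
    (hns : ¬ ∀ m : ℕ, V.HasSurjectiveModNGaloisRep (p ^ m : ℕ))
    (hP : haveI : NumberField (V.divisionField p) := NumberField.mk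
      ∃ P : geomTorsion V (p : ℤ), P ≠ 0 ∧
        ∀ K : IntermediateField ℚ (V.divisionField p),
          K = IntermediateField.fixedField
            ((MulAction.stabilizer (absoluteGaloisGroup ℚ) P).map (absRestrictNormalHom (V.divisionField p))) →
        ∀ μ : Additive (ClassGroup (𝓞 K)) →+ ZMod p,
          (∀ (τ : absoluteGaloisGroup ℚ) (σ : K ≃ₐ[ℚ] K) (a : ℕ),
              (∀ x : K, absRestrictNormalHom (V.divisionField p) τ (x : V.divisionField p) =
                ((σ x : K) : V.divisionField p)) → τ • P = a • P →
              ∀ (I J : (Ideal (𝓞 K))⁰),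
                (J : Ideal (𝓞 K)) = (I : Ideal (𝓞 K)).map (AmbiguousClass.intAut σ : 𝓞 K →+* 𝓞 K) →
                μ (Additive.ofMul (ClassGroup.mk0 J)) = a • μ (Additive.ofMul (ClassGroup.mk0 I))) →
          (∀ (τ τ₁ : absoluteGaloisGroup ℚ) (a a₁ b : ℕ) (Q : geomTorsion V (p : ℤ)),
              τ • P = a • P + Q → τ₁ • P = a₁ • P → τ₁ • Q = b • Q → (a₁ : ZMod p) ≠ (b : ZMod p) →
              ∀ I : (Ideal (𝓞 K))⁰,
                μ (Additive.ofMul (classGroupNorm K (V.divisionField p) (ClassGroup.mulEquiv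
                  (AmbiguousClass.intAut (absRestrictNormalHom (V.divisionField p) τ))
                    (classGroupExtend K (V.divisionField p) (ClassGroup.mk0 I))))) =
                  (Nat.card ((V.divisionField p) ≃ₐ[K] (V.divisionField p)) * a) •
                    μ (Additive.ofMul (ClassGroup.mk0 I))) →
          μ = 0)
    (κ : ZpExtension ℚ p) (hκ : κ.IsCyclotomic) :
    ∃ (γ : absoluteGaloisGroup ℚ) (D : V.FineSelmerDualData κ γ),
      Module.Finite ℤ_[p] (RestrictScalars ℤ_[p] (IwasawaAlgebra p) D.X) := by
  haveI : NumberField (V.divisionField p) := NumberField.mk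
  obtain ⟨P, hP0, h⟩ := hP
  set K : IntermediateField ℚ (V.divisionField p) := IntermediateField.fixedField
    ((MulAction.stabilizer (absoluteGaloisGroup ℚ) P).map (absRestrictNormalHom (V.divisionField p))) with hKdef
  refine conjA_of_heckeEigenHom_subfield p V (by omega) (irreducible_of_row V p hp5 hgood hap)
    (not_dvd_card_aut_divisionField_of_row V p hp5 hgood hap hns) K P hP0 ?_
    (fun v hv => stabilizerField_fixed_line_of_row p V hp5 hgood hap hns P hP0 K hKdef v hv) (h K hKdef) hκ
    (fun v hv x hpx hx => geomPrimaryTorsion_fixed_eq_zero_of_row V p hp5 hgood hap v hv x hpx hx)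
  -- `Γ_{ℚ(P)}` fixes `P`
  intro τ' hτ'
  have hmem : absRestrictNormalHom (V.divisionField p) τ' ∈
      (MulAction.stabilizer (absoluteGaloisGroup ℚ) P).map (absRestrictNormalHom (V.divisionField p)) := by
    rw [← IntermediateField.fixingSubgroup_fixedField
      ((MulAction.stabilizer (absoluteGaloisGroup ℚ) P).map (absRestrictNormalHom (V.divisionField p))),
      IntermediateField.mem_fixingSubgroup_iff]
    intro x hx
    exact hτ' ⟨x, hx⟩
  obtain ⟨τ₀, hτ₀, hres⟩ := Subgroup.mem_map.mp hmem
  have h1 : absRestrictNormalHom (V.divisionField p) (τ₀⁻¹ * τ') = 1 := by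
    rw [map_mul, map_inv, hres, inv_mul_cancel]
  have h2 := (V.absRestrictNormalHom_divisionField_eq_one_iff p (τ₀⁻¹ * τ')).mp h1 P
  rw [mul_smul, inv_smul_eq_iff] at h2
  rw [h2]; exact hτ₀

end K8

end Summit.BirchSwinnertonDyer.BirchSwinnertonDyer.Theorems.EtaConjADoorHecke

end
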